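import Summits.BirchSwinnertonDyer.BirchSwinnertonDyer.Theorems.ByReductionTypeAtTwoSupersingularUnitAnchorTransportFlat
import Summits.BirchSwinnertonDyer.BirchSwinnertonDyer.Theorems.ByReductionTypeAtTwoSupersingularFlatClassKit
import Summits.BirchSwinnertonDyer.BirchSwinnertonDyer.Theorems.ThetaPartnerAtTwoTwoTorsionCongruence
import HarnessLib

/-!
# Crux `SupersingularRankZeroAtTwo` (item stmt-BirchSwinnertonDyer-19097): the UNIT-ANCHOR KIT DOOR on `♭` objects and
# integer models (`a₂ = ±2`) — the Kato half / BSD₂ of `M_E ⊗ ℚ` from a unit-zone anchor `M_A ⊗ ℚ` with the same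
# `#Ẽ(𝔽₂) ∈ {1, 5}`, a Tschirnhaus pair certifying `E[2] ≅ A[2]`, and the `♭` binders at the pair (seat `bsd-2adic-ss-1x` GEN 4)

HONEST FRAMING (cells `bsd-2adic` / `bsd-wall`; HUMAN RULINGS D-0036/D-0054/D-0074): THEOREMS ONLY — no definition, no named fact,
no instance, no `sorry`; nothing about any curve is asserted beyond the displayed binders; closes nothing; BSD is NOT proved by any
of this. PARTITION (D-0054): X5@2 good-supersingular `a₂ = ±2`, UNIT-ANCHOR sub-row (45/549 rank-`0` classes; UNIT-ANCHOR-CENSUS-v1)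
× `p = 2` — types-the-object-of; bears_on K4 19097.

`missingUpperBoundAt_two_baseChange_int_of_unitAnchor_flat` / `bsdp_two_baseChange_int_of_unitAnchor_flat`: KERNEL inputs decided
per class on literals — `2 ∤ Δ(M_E)`, `2 ∤ Δ(M_A)`, `#M̃_E(𝔽₂) = #M̃_A(𝔽₂) = k ∈ {1, 5}` (so both are good supersingular at `2` with
the SAME `a₂ = 3 − k ∈ {2, −2}`), a Tschirnhaus pair `(q, r)` on the `2`-division cubics (`E[2] ≅ A[2]`, certificate theorem p530091);
PUB {`hmod`, `hGZK`, `h124`, `hX0`}; CERT {`L(E,1) ≠ 0`, `L(A,1) ≠ 0`, `2 ∤ ∏c_ℓ(A)`, `2 ∤ #Ш(A)`, (`hsha`)}; and for ARBITRARY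
supplied data `(κ, γ, ι, g, c, c_A)` the research binders of `SSUnitAnchor.missingUpperBoundAt_two_of_unitAnchor_flat`: EC♭ at `E`
(`hEC`), the RATIONAL `♭` Coleman–Kato package at `E` (`hCK`, no `TwoAdicSurjective` conjunct), control-finiteness and EC♭ at `A`
(`hfinA`, `hECA`), and the `♭` `μ`-transport at the pair (`hmuT`). ⟹ `MissingUpperBoundAt (M_E ⊗ ℚ) 2`, resp. `BSDp (M_E ⊗ ℚ) 2`.

References: [Sprung2012] Thm. 7.14, 7.16; [Sprung2024] §5.2; [BDKim2009] Cor. 2.13; [Kato2004Asterisque] Thm. 12.4–12.5 (3);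
[SilvermanAEC2009] III.§1, VII.5 Prop. 5.1; [Miller2011LMS] Def. 1.1; UNIT-ANCHOR-CENSUS-v1.md.
-/

set_option autoImplicit false
-- the Theorems namespace of this sub repeats the summit name by design (D-0017 nested layout)
set_option linter.dupNamespace false

noncomputable section

open scoped Classical MatrixGroups ModularForm Polynomial

open CongruenceSubgroup WeierstrassCurve Literature.NumberTheory.EllipticCurves
  Literature.NumberTheory.EllipticCurves.ModularForms Literature.NumberTheory.EllipticCurves.Sprung2017
  Literature.NumberTheory.EllipticCurves.Sprung2012
  Literature.NumberTheory.EllipticCurves.Rank1Residual Literature.NumberTheory.EllipticCurves.Rank1Residual.Typed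
  Literature.NumberTheory.EllipticCurves.IwasawaDual Literature.NumberTheory.GaloisRepresentations
  ZpExtension Summit.BirchSwinnertonDyer.Rank1Residual Summit.BirchSwinnertonDyer.Rank1Residual.Supersingular
  Summit.BirchSwinnertonDyer.Rank1Residual.X5 Summit.BirchSwinnertonDyer.Rank1Residual.X5.O1
  Summit.BirchSwinnertonDyer.Rank1Residual.X5.Instances

universe u

namespace Summit.BirchSwinnertonDyer.BirchSwinnertonDyer.Theorems
namespace SSUnitAnchor

section Door

variable (ME MA : WeierstrassCurve ℤ)
  [(ME.baseChange ℚ).IsElliptic] [(ME.baseChange ℚ).IsGloballyMinimal]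
  [(MA.baseChange ℚ).IsElliptic] [(MA.baseChange ℚ).IsGloballyMinimal]

/-- **THE `♭` KIT DOOR, upper half** (see the module docstring for the binder legend). [cite: Sprung2012, Thm. 7.14 and Thm. 7.16]
[cite: BDKim2009, Cor. 2.13] [cite: Kato2004Asterisque, Thm. 12.4–12.5 (3)] [cite: SilvermanAEC2009, III.§1 and VII.5 Prop. 5.1(a)]
[cite: Miller2011LMS, Def. 1.1] -/
theorem missingUpperBoundAt_two_baseChange_int_of_unitAnchor_flat
    (hmod : nonempty_modularParametrizationData) (hGZK : rank_eq_analyticRank_of_analyticRank_le_one)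
    (h124 : Kato2004.thm12_4) (hX0 : Kato2004_fineSelmerDual_isTorsion)
    (hΔE : ¬ (2 : ℤ) ∣ ME.Δ) (hΔA : ¬ (2 : ℤ) ∣ MA.Δ) {k : ℕ}
    (hcardE : Nat.card (ME.map (Int.castRingHom (ZMod 2))).toAffine.Point = k)
    (hcardA : Nat.card (MA.map (Int.castRingHom (ZMod 2))).toAffine.Point = k) (hk : k = 1 ∨ k = 5)
    (hL : (ME.baseChange ℚ).entireLFunction 1 ≠ 0) (hLA : (MA.baseChange ℚ).entireLFunction 1 ≠ 0)
    (hTam : ¬ 2 ∣ (MA.baseChange ℚ).tamagawaProduct) (hSha : ¬ 2 ∣ (MA.baseChange ℚ).shaOrder)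
    (q r : ℚ[X])
    (hroot : ∀ ξ : AlgebraicClosure ℚ, Polynomial.aeval ξ (ME.baseChange ℚ).twoTorsionPolynomial.toPoly = 0 →
      Polynomial.aeval (Polynomial.aeval ξ q) (MA.baseChange ℚ).twoTorsionPolynomial.toPoly = 0)
    (hinv : ∀ ξ : AlgebraicClosure ℚ, Polynomial.aeval ξ (ME.baseChange ℚ).twoTorsionPolynomial.toPoly = 0 →
      Polynomial.aeval (Polynomial.aeval ξ q) r = ξ) :
    ∀ (κ : ZpExtension ℚ 2) (γ : Field.absoluteGaloisGroup ℚ), κ.IsCyclotomic → κ.IsTopGenerator γ →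
    ∀ {E : Type} [Field E] [Algebra ℚ E] (ι : AlgebraicClosure ℚ →ₐ[ℚ] AlgebraicClosure E)
      (g : Field.absoluteGaloisGroup E) (c : ℕ → localPoints (ME.baseChange ℚ) E) (cA : ℕ → localPoints (MA.baseChange ℚ) E),
    (∀ (D : SharpFlatSelmerDualData (ME.baseChange ℚ) κ γ ι ((ME.baseChange ℚ).frobeniusTrace 2) g c .flat)
        [Module.Finite (IwasawaAlgebra 2) D.X], Module.IsTorsion (IwasawaAlgebra 2) D.X →
      ∀ f : IwasawaAlgebra 2, D.charIdeal = Ideal.span {f} → Finite ((ME.baseChange ℚ).selmerGroupPInfty 2) →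
        ∃ u : ℤ_[2]ˣ, ((PowerSeries.constantCoeff f : ℤ_[2]) : ℚ_[2]) =
          ((u : ℤ_[2]) : ℚ_[2]) * ((2 : ℕ) : ℚ_[2]) ^ (padicValNat 2 (ME.baseChange ℚ).tamagawaProduct) *
            (Nat.card ((ME.baseChange ℚ).selmerGroupPInfty 2) : ℚ_[2])) →
    (∀ [NeZero ((ME.baseChange ℚ).conductorNorm ℤ)] (f : CuspForm (Gamma0 ((ME.baseChange ℚ).conductorNorm ℤ)) 2),
        IsNewformOf (ME.baseChange ℚ) f → ∀ (ϖ : ℚ), (ϖ : ℝ) * (ME.baseChange ℚ).realPeriodRat = plusPeriod f →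
      ∀ (Ls Lf : IwasawaAlgebra 2), IsSprungPair f 2 ((ME.baseChange ℚ).frobeniusTrace 2) Ls Lf →
      ∀ (D : SharpFlatSelmerDualData (ME.baseChange ℚ) κ γ ι ((ME.baseChange ℚ).frobeniusTrace 2) g c .flat)
        [ContinuousSMul ℤ_[2] ((ME.baseChange ℚ).tateModule 2)],
        ∃ (I : Kato2004.IwasawaH1Data (ME.baseChange ℚ) 2 κ γ) (Y : (ME.baseChange ℚ).FineSelmerDualData κ γ)
          (P : Submodule (IwasawaAlgebra 2) (IwasawaAlgebra 2))
          (loc : I.H →ₗ[IwasawaAlgebra 2] P) (toX : P →ₗ[IwasawaAlgebra 2] D.X)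
          (δ : D.X →ₗ[IwasawaAlgebra 2] Y.X) (Z : Submodule (IwasawaAlgebra 2) I.H)
          (G : IwasawaAlgebra 2),
          Function.Exact loc toX ∧ Function.Exact toX δ ∧
          G ∈ Submodule.map (P.subtype ∘ₗ loc) Z ∧
          iwasawaToPowerSeries 2 G = PowerSeries.C (ϖ : ℚ_[2]) * iwasawaToPowerSeries 2 Lf ∧
          (∀ 𝔭 : PrimeSpectrum (IwasawaAlgebra 2), 𝔭.asIdeal.height = 1 →
            PowerSeries.C (2 : ℤ_[2]) ∉ 𝔭.asIdeal →
            Literature.NumberTheory.EllipticCurves.Module.lengthAt (IwasawaAlgebra 2) Y.X 𝔭 ≤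
              Literature.NumberTheory.EllipticCurves.Module.lengthAt (IwasawaAlgebra 2) (I.H ⧸ Z) 𝔭)) →
    (Finite ((MA.baseChange ℚ).selmerGroupPInfty 2) →
      Finite (endInvariants (conjSharpFlatSelmerInfty (MA.baseChange ℚ) κ ι ((MA.baseChange ℚ).frobeniusTrace 2) g cA .flat γ - 1))) →
    (∀ (D : SharpFlatSelmerDualData (MA.baseChange ℚ) κ γ ι ((MA.baseChange ℚ).frobeniusTrace 2) g cA .flat)
        [Module.Finite (IwasawaAlgebra 2) D.X], Module.IsTorsion (IwasawaAlgebra 2) D.X →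
      ∀ f : IwasawaAlgebra 2, D.charIdeal = Ideal.span {f} → Finite ((MA.baseChange ℚ).selmerGroupPInfty 2) →
        ∃ u : ℤ_[2]ˣ, ((PowerSeries.constantCoeff f : ℤ_[2]) : ℚ_[2]) =
          ((u : ℤ_[2]) : ℚ_[2]) * ((2 : ℕ) : ℚ_[2]) ^ (padicValNat 2 (MA.baseChange ℚ).tamagawaProduct) *
            (Nat.card ((MA.baseChange ℚ).selmerGroupPInfty 2) : ℚ_[2])) →
    ((ME.baseChange ℚ).HasGoodReductionAtPrime 2 → (MA.baseChange ℚ).HasGoodReductionAtPrime 2 →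
      (ME.baseChange ℚ).frobeniusTrace 2 = (MA.baseChange ℚ).frobeniusTrace 2 →
      (∃ e : WeierstrassCurve.geomTorsion (ME.baseChange ℚ) (2 : ℤ) ≃+ WeierstrassCurve.geomTorsion (MA.baseChange ℚ) (2 : ℤ),
        ∀ (σ : Field.absoluteGaloisGroup ℚ) (P : WeierstrassCurve.geomTorsion (ME.baseChange ℚ) (2 : ℤ)), e (σ • P) = σ • e P) →
      (∀ (D' : SharpFlatSelmerDualData (MA.baseChange ℚ) κ γ ι ((MA.baseChange ℚ).frobeniusTrace 2) g cA .flat) (g' : IwasawaAlgebra 2),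
          Module.IsTorsion (IwasawaAlgebra 2) D'.X ∧ (D'.charIdeal = Ideal.span {g'} → ¬ PowerSeries.C (2 : ℤ_[2]) ∣ g')) →
      ∀ (D : SharpFlatSelmerDualData (ME.baseChange ℚ) κ γ ι ((ME.baseChange ℚ).frobeniusTrace 2) g c .flat) (g' : IwasawaAlgebra 2),
        D.charIdeal = Ideal.span {g'} → ¬ PowerSeries.C (2 : ℤ_[2]) ∣ g') →
    MissingUpperBoundAt (ME.baseChange ℚ) 2 := by
  intro κ γ hκ hγ E _ _ ι g c cA hEC hCK hfinA hECA hmuT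
  obtain ⟨hgood, -, hssE⟩ := SSFlatRoad.goodSS_two_baseChange_int_of_card ME hΔE hcardE hk
  obtain ⟨hAgood, -, -⟩ := SSFlatRoad.goodSS_two_baseChange_int_of_card MA hΔA hcardA hk
  have ha : (ME.baseChange ℚ).frobeniusTrace 2 = (MA.baseChange ℚ).frobeniusTrace 2 := by
    rw [frobeniusTrace_two_baseChange_int ME hcardE, frobeniusTrace_two_baseChange_int MA hcardA]
  obtain ⟨e, he⟩ := ThetaPartnerXRoute.exists_equivariant_addEquiv_geomTorsion_two_of_tschirnhaus (K := ℚ)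
    two_ne_zero (ME.baseChange ℚ) (MA.baseChange ℚ) q r hroot hinv
  exact missingUpperBoundAt_two_of_unitAnchor_flat (ME.baseChange ℚ) (MA.baseChange ℚ) ι g c cA hmod hGZK h124 hX0
    hgood hssE.2 hL hAgood ha hLA hTam hSha e he hκ hγ hEC hCK hfinA hECA hmuT

/-- **THE `♭` KIT DOOR, BSD₂** (the upper half above + the class's Miller lower certificate `hsha`). [cite: Miller2011LMS, Def. 1.1]
[cite: Sprung2012, Thm. 7.16] [cite: BDKim2009, Cor. 2.13] [cite: Kato2004Asterisque, Thm. 12.5 (3)] [cite: SilvermanAEC2009, III.§1] -/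
theorem bsdp_two_baseChange_int_of_unitAnchor_flat
    (hmod : nonempty_modularParametrizationData) (hGZK : rank_eq_analyticRank_of_analyticRank_le_one)
    (h124 : Kato2004.thm12_4) (hX0 : Kato2004_fineSelmerDual_isTorsion)
    (hΔE : ¬ (2 : ℤ) ∣ ME.Δ) (hΔA : ¬ (2 : ℤ) ∣ MA.Δ) {k : ℕ}
    (hcardE : Nat.card (ME.map (Int.castRingHom (ZMod 2))).toAffine.Point = k)
    (hcardA : Nat.card (MA.map (Int.castRingHom (ZMod 2))).toAffine.Point = k) (hk : k = 1 ∨ k = 5)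
    (hL : (ME.baseChange ℚ).entireLFunction 1 ≠ 0) (hLA : (MA.baseChange ℚ).entireLFunction 1 ≠ 0)
    (hTam : ¬ 2 ∣ (MA.baseChange ℚ).tamagawaProduct) (hSha : ¬ 2 ∣ (MA.baseChange ℚ).shaOrder)
    (q r : ℚ[X])
    (hroot : ∀ ξ : AlgebraicClosure ℚ, Polynomial.aeval ξ (ME.baseChange ℚ).twoTorsionPolynomial.toPoly = 0 →
      Polynomial.aeval (Polynomial.aeval ξ q) (MA.baseChange ℚ).twoTorsionPolynomial.toPoly = 0)
    (hinv : ∀ ξ : AlgebraicClosure ℚ, Polynomial.aeval ξ (ME.baseChange ℚ).twoTorsionPolynomial.toPoly = 0 →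
      Polynomial.aeval (Polynomial.aeval ξ q) r = ξ)
    (hsha : MissingLowerBoundAt (ME.baseChange ℚ) 2) :
    ∀ (κ : ZpExtension ℚ 2) (γ : Field.absoluteGaloisGroup ℚ), κ.IsCyclotomic → κ.IsTopGenerator γ →
    ∀ {E : Type} [Field E] [Algebra ℚ E] (ι : AlgebraicClosure ℚ →ₐ[ℚ] AlgebraicClosure E)
      (g : Field.absoluteGaloisGroup E) (c : ℕ → localPoints (ME.baseChange ℚ) E) (cA : ℕ → localPoints (MA.baseChange ℚ) E),
    (∀ (D : SharpFlatSelmerDualData (ME.baseChange ℚ) κ γ ι ((ME.baseChange ℚ).frobeniusTrace 2) g c .flat)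
        [Module.Finite (IwasawaAlgebra 2) D.X], Module.IsTorsion (IwasawaAlgebra 2) D.X →
      ∀ f : IwasawaAlgebra 2, D.charIdeal = Ideal.span {f} → Finite ((ME.baseChange ℚ).selmerGroupPInfty 2) →
        ∃ u : ℤ_[2]ˣ, ((PowerSeries.constantCoeff f : ℤ_[2]) : ℚ_[2]) =
          ((u : ℤ_[2]) : ℚ_[2]) * ((2 : ℕ) : ℚ_[2]) ^ (padicValNat 2 (ME.baseChange ℚ).tamagawaProduct) *
            (Nat.card ((ME.baseChange ℚ).selmerGroupPInfty 2) : ℚ_[2])) →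
    (∀ [NeZero ((ME.baseChange ℚ).conductorNorm ℤ)] (f : CuspForm (Gamma0 ((ME.baseChange ℚ).conductorNorm ℤ)) 2),
        IsNewformOf (ME.baseChange ℚ) f → ∀ (ϖ : ℚ), (ϖ : ℝ) * (ME.baseChange ℚ).realPeriodRat = plusPeriod f →
      ∀ (Ls Lf : IwasawaAlgebra 2), IsSprungPair f 2 ((ME.baseChange ℚ).frobeniusTrace 2) Ls Lf →
      ∀ (D : SharpFlatSelmerDualData (ME.baseChange ℚ) κ γ ι ((ME.baseChange ℚ).frobeniusTrace 2) g c .flat)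
        [ContinuousSMul ℤ_[2] ((ME.baseChange ℚ).tateModule 2)],
        ∃ (I : Kato2004.IwasawaH1Data (ME.baseChange ℚ) 2 κ γ) (Y : (ME.baseChange ℚ).FineSelmerDualData κ γ)
          (P : Submodule (IwasawaAlgebra 2) (IwasawaAlgebra 2))
          (loc : I.H →ₗ[IwasawaAlgebra 2] P) (toX : P →ₗ[IwasawaAlgebra 2] D.X)
          (δ : D.X →ₗ[IwasawaAlgebra 2] Y.X) (Z : Submodule (IwasawaAlgebra 2) I.H)
          (G : IwasawaAlgebra 2),
          Function.Exact loc toX ∧ Function.Exact toX δ ∧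
          G ∈ Submodule.map (P.subtype ∘ₗ loc) Z ∧
          iwasawaToPowerSeries 2 G = PowerSeries.C (ϖ : ℚ_[2]) * iwasawaToPowerSeries 2 Lf ∧
          (∀ 𝔭 : PrimeSpectrum (IwasawaAlgebra 2), 𝔭.asIdeal.height = 1 →
            PowerSeries.C (2 : ℤ_[2]) ∉ 𝔭.asIdeal →
            Literature.NumberTheory.EllipticCurves.Module.lengthAt (IwasawaAlgebra 2) Y.X 𝔭 ≤
              Literature.NumberTheory.EllipticCurves.Module.lengthAt (IwasawaAlgebra 2) (I.H ⧸ Z) 𝔭)) →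
    (Finite ((MA.baseChange ℚ).selmerGroupPInfty 2) →
      Finite (endInvariants (conjSharpFlatSelmerInfty (MA.baseChange ℚ) κ ι ((MA.baseChange ℚ).frobeniusTrace 2) g cA .flat γ - 1))) →
    (∀ (D : SharpFlatSelmerDualData (MA.baseChange ℚ) κ γ ι ((MA.baseChange ℚ).frobeniusTrace 2) g cA .flat)
        [Module.Finite (IwasawaAlgebra 2) D.X], Module.IsTorsion (IwasawaAlgebra 2) D.X →
      ∀ f : IwasawaAlgebra 2, D.charIdeal = Ideal.span {f} → Finite ((MA.baseChange ℚ).selmerGroupPInfty 2) →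
        ∃ u : ℤ_[2]ˣ, ((PowerSeries.constantCoeff f : ℤ_[2]) : ℚ_[2]) =
          ((u : ℤ_[2]) : ℚ_[2]) * ((2 : ℕ) : ℚ_[2]) ^ (padicValNat 2 (MA.baseChange ℚ).tamagawaProduct) *
            (Nat.card ((MA.baseChange ℚ).selmerGroupPInfty 2) : ℚ_[2])) →
    ((ME.baseChange ℚ).HasGoodReductionAtPrime 2 → (MA.baseChange ℚ).HasGoodReductionAtPrime 2 →
      (ME.baseChange ℚ).frobeniusTrace 2 = (MA.baseChange ℚ).frobeniusTrace 2 →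
      (∃ e : WeierstrassCurve.geomTorsion (ME.baseChange ℚ) (2 : ℤ) ≃+ WeierstrassCurve.geomTorsion (MA.baseChange ℚ) (2 : ℤ),
        ∀ (σ : Field.absoluteGaloisGroup ℚ) (P : WeierstrassCurve.geomTorsion (ME.baseChange ℚ) (2 : ℤ)), e (σ • P) = σ • e P) →
      (∀ (D' : SharpFlatSelmerDualData (MA.baseChange ℚ) κ γ ι ((MA.baseChange ℚ).frobeniusTrace 2) g cA .flat) (g' : IwasawaAlgebra 2),
          Module.IsTorsion (IwasawaAlgebra 2) D'.X ∧ (D'.charIdeal = Ideal.span {g'} → ¬ PowerSeries.C (2 : ℤ_[2]) ∣ g')) →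
      ∀ (D : SharpFlatSelmerDualData (ME.baseChange ℚ) κ γ ι ((ME.baseChange ℚ).frobeniusTrace 2) g c .flat) (g' : IwasawaAlgebra 2),
        D.charIdeal = Ideal.span {g'} → ¬ PowerSeries.C (2 : ℤ_[2]) ∣ g') →
    BSDp (ME.baseChange ℚ) 2 := by
  intro κ γ hκ hγ E _ _ ι g c cA hEC hCK hfinA hECA hmuT
  exact bsdp_of_missingPPartAt (ME.baseChange ℚ) 2 hGZK
    ((analyticRank_eq_zero_of_entireLFunction_one_ne_zero _ hL).le.trans zero_le_one)
    (missingPPartAt_of_lower_of_upper (ME.baseChange ℚ) 2 hsha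
      (missingUpperBoundAt_two_baseChange_int_of_unitAnchor_flat ME MA hmod hGZK h124 hX0 hΔE hΔA hcardE hcardA hk hL hLA
        hTam hSha q r hroot hinv κ γ hκ hγ ι g c cA hEC hCK hfinA hECA hmuT))

end Door

end SSUnitAnchor
end Summit.BirchSwinnertonDyer.BirchSwinnertonDyer.Theorems

end
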